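import Summits.CriticalPhenomena.PercolationContinuityZ3.Theorems.PercNearOneGluingNoHeavyLowerTailStarSetWordDesignations
import Summits.CriticalPhenomena.PercolationContinuityZ3.Theorems.PercNearOneGluingNoHeavyLowerTailStarSetWordCaps
import Summits.CriticalPhenomena.PercolationContinuityZ3.Theorems.PercNearOneGluingNoHeavyLowerTailStarSetFamilyLoad
import Summits.CriticalPhenomena.PercolationContinuityZ3.Theorems.PercNearOneGluingNoHeavyLowerTailStarSetOmegaCliques
import HarnessLib

/-!
# `NoHeavyLowerTail` (stmt-CriticalPhenomena-4575) — the chord-rider family of the residual bound (U1-PROOF.md §6, W-C; blueprint §G4)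

Support file (prover `prim-gen-swap` gen 15; `--supports stmt-CriticalPhenomena-4575`).  No definitions, no named facts, no sorries.

A residual configuration of a `𝓤_dom` pair `(X, J)` (`X = {e, ē}` a chord avoiding `r`, `J = {e, s} ∈ F` avoiding `r`) with a
CHORD rider `ρ = {e, m}` at `e` (a "HotC" rider) requests the W-C word on `T = {X, J, ρ}` with the designations
`(X→ē, J→s, ρ→m)`, `(X→ē, J→e, ρ→m)` (both chords designated AWAY from the forest class `J`), capacity `≥ 8 θ_Xθ_ρθ_J`
(`riderC_word_cap_ge`).  The class-set `T` (STAR2 shape: two chords and a forest class through a common port) is shared with the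
pool's CROSS word, whose designations point a chord INTO `J`; so this family is charged against the part `wc(T)` of `C_T` made of the
designations that point every chord of `T` away from every forest class of `T`, with coefficient `6/8` (at most six claimant keys per
class-set).

* `StarSet.riderC_triple_le_wc` — `8 θ_Xθ_Jθ_ρ ≤ wc(T)`;
* `StarSet.familyRiderC_bound` — `Σ_{u∈U} W(S_u) ≤ (6/8) Σ_{T ∈ res(U)} wc(T)`.
-/

namespace Summit.CriticalPhenomena.PercolationContinuityZ3.Theorems

open Finset
open scoped BigOperators Classical

namespace StarSet

variable {ι V : Type*} [Fintype ι] [LinearOrder ι] [DecidableEq V]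

/-- **The W-C word: `8 θ_Xθ_Jθ_ρ ≤ wc(T)`** for `T = {X, J, ρ}`, `X = {e, ē}`, `ρ = {e, m}` chords and `J = {e, s}` the only forest
class of `T` (`ē, s, m` pairwise distinct; all ports `≠ r`). -/
theorem riderC_triple_le_wc (P P' : ι → V) (r : V) (F : Finset ι)
    (θ : ι → ℝ) (hθ0 : ∀ X, 0 ≤ θ X) (O : ι → V → ℝ) (hO0 : ∀ X d, 0 ≤ O X d) (Φ : ι → ℝ)
    (hO1 : ∀ X d, (P X = d ∨ P' X = d) → θ X ≤ (1 - θ X) * O X d)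
    (hO2 : ∀ X, Φ X ^ 2 ≤ O X (P X) * O X (P' X)) (hΦ4 : ∀ X, 4 * θ X ≤ Φ X)
    {X J ρ : ι} (hXJ : X ≠ J) (hXρ : X ≠ ρ) (hJρ : J ≠ ρ) (hXF : X ∉ F) (hρF : ρ ∉ F) {e ē s m : V}
    (heX : P X = e ∨ P' X = e) (hēX : P X = ē ∨ P' X = ē) (heJ : P J = e ∨ P' J = e) (hsJ : P J = s ∨ P' J = s)
    (hmρ : P ρ = m ∨ P' ρ = m)
    (heē : e ≠ ē) (hes : e ≠ s) (hem : e ≠ m) (hēs : ē ≠ s) (hēm : ē ≠ m) (hsm : s ≠ m)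
    (hēr : ē ≠ r) (her : e ≠ r) (hsr : s ≠ r) (hmr : m ≠ r) :
    8 * (θ X * θ J * θ ρ) ≤
      ∑ δ ∈ ((univ : Finset (ι → Bool)).filter (fun δ => (∀ K ∉ ({X, J, ρ} : Finset ι), δ K = false) ∧
          3 ≤ (({X, J, ρ} : Finset ι).image fun K => if δ K then P K else P' K).card ∧
          r ∉ ({X, J, ρ} : Finset ι).image fun K => if δ K then P K else P' K)).filter
          (fun δ => ∀ K ∈ ({X, J, ρ} : Finset ι), K ∉ F → ∀ I ∈ ({X, J, ρ} : Finset ι), I ∈ F →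
            (if δ K then P K else P' K) ≠ P I ∧ (if δ K then P K else P' K) ≠ P' I),
        ∏ K ∈ ({X, J, ρ} : Finset ι), O K (if δ K then P K else P' K) := by
  have hOJ : Φ J ^ 2 ≤ O J s * O J e := odds_pair_of_ports P P' O Φ (sym2_eq_of_mem_of_mem hes.symm hsJ heJ) (hO2 J)
  have h8 := riderC_word_cap_ge (θ X) (θ ρ) (θ J) (Φ J) (O X ē) (O ρ m) (O J s) (O J e)
    (hθ0 X) (hθ0 ρ) (hθ0 J) (hΦ4 J) (hO0 _ _) (hO0 _ _) (hO0 _ _) (hO0 _ _) (hO1 X ē hēX) (hO1 ρ m hmρ) hOJ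
  -- `J` is the only forest class of `T`; its ports are `e, s`
  have hJports : ∀ q, (P J = q ∨ P' J = q) → q = e ∨ q = s :=
    fun q hq => (ports_iff_of_pair P P' (sym2_eq_of_mem_of_mem hes heJ hsJ) q).1 hq
  have hJF_only : ∀ I ∈ ({X, J, ρ} : Finset ι), I ∈ F → I = J := by
    intro I hI hIF
    rcases mem_insert.1 hI with rfl | hI
    · exact absurd hIF hXF
    rcases mem_insert.1 hI with h | hI
    · exact h
    · rw [mem_singleton.1 hI] at hIF; exact absurd hIF hρF
  -- the predicate for a designation with known ports on `X` and `ρ`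
  have hQ : ∀ δ : ι → Bool, (if δ X then P X else P' X) = ē → (if δ ρ then P ρ else P' ρ) = m →
      ∀ K ∈ ({X, J, ρ} : Finset ι), K ∉ F → ∀ I ∈ ({X, J, ρ} : Finset ι), I ∈ F →
        (if δ K then P K else P' K) ≠ P I ∧ (if δ K then P K else P' K) ≠ P' I := by
    intro δ hX' hρ' K hK hKF I hI hIF
    obtain rfl := hJF_only I hI hIF
    have hnot : ∀ q, q ≠ e → q ≠ s → q ≠ P I ∧ q ≠ P' I := by
      intro q hqe hqs
      constructor
      · intro h; rcases hJports q (Or.inl h.symm) with h' | h'; exacts [hqe h', hqs h']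
      · intro h; rcases hJports q (Or.inr h.symm) with h' | h'; exacts [hqe h', hqs h']
    rcases mem_insert.1 hK with rfl | hK
    · rw [hX']; exact hnot ē heē.symm hēs
    rcases mem_insert.1 hK with rfl | hK
    · exact absurd hIF hKF
    · rw [mem_singleton.1 hK, hρ']; exact hnot m hem.symm hsm.symm
  obtain ⟨-, hx1, -, hx3, -⟩ := designation_valid P P' r O hXJ hXρ hJρ hēX hsJ hmρ hēs hēm hsm hēr hsr hmr
  obtain ⟨-, hy1, -, hy3, -⟩ := designation_valid P P' r O hXJ hXρ hJρ hēX heJ hmρ heē.symm hēm hem hēr her hmr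
  have hw := two_words_le_cap_filter P P' r O hO0 hXJ hXρ hJρ hēX hsJ hmρ hēs hēm hsm hēr hsr hmr
    hēX heJ hmρ heē.symm hēm hem hēr her hmr (Or.inr (Or.inl hes.symm))
    (fun δ => ∀ K ∈ ({X, J, ρ} : Finset ι), K ∉ F → ∀ I ∈ ({X, J, ρ} : Finset ι), I ∈ F →
      (if δ K then P K else P' K) ≠ P I ∧ (if δ K then P K else P' K) ≠ P' I)
    (hQ _ hx1 hx3) (hQ _ hy1 hy3)
  have : O X ē * O ρ m * O J s + O X ē * O ρ m * O J e = O X ē * O J s * O ρ m + O X ē * O J e * O ρ m := by ring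
  nlinarith [hθ0 X, hθ0 J, hθ0 ρ]

/-- **The chord-rider family bound (U1-PROOF §6, W-C).**  Units `(S, X)`: hub `X = u.2 ∈ S` a chord avoiding `r`, forest partner
`J = Jof u ∈ S` avoiding `r` and chord rider `ρ = rof u ∈ S` avoiding `r`, `ρ ≠ X`, both meeting `X` at the port `eof u`.
Then `Σ_{u∈U} W(S_u) ≤ (6/8) Σ_{T ∈ U.image {X,J,ρ}} wc(T)`. -/
theorem familyRiderC_bound (P P' : ι → V) (hPP' : ∀ X, P X ≠ P' X)
    (hinj : Function.Injective fun X => (s(P X, P' X) : Sym2 V)) (r : V) (F : Finset ι)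
    (θ : ι → ℝ) (hθ0 : ∀ X, 0 ≤ θ X) (hθ1 : ∀ X, θ X ≤ 1) (O : ι → V → ℝ) (hO0 : ∀ X d, 0 ≤ O X d) (Φ : ι → ℝ)
    (hO1 : ∀ X d, (P X = d ∨ P' X = d) → θ X ≤ (1 - θ X) * O X d)
    (hO2 : ∀ X, Φ X ^ 2 ≤ O X (P X) * O X (P' X)) (hΦ4 : ∀ X, 4 * θ X ≤ Φ X)
    (U : Finset (Finset ι × ι)) (Jof rof : Finset ι × ι → ι) (eof : Finset ι × ι → V)
    (hU : ∀ u ∈ U, u.2 ∈ u.1 ∧ u.2 ∉ F ∧ (P u.2 ≠ r ∧ P' u.2 ≠ r) ∧ (P u.2 = eof u ∨ P' u.2 = eof u) ∧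
      Jof u ∈ u.1 ∧ Jof u ∈ F ∧ (P (Jof u) ≠ r ∧ P' (Jof u) ≠ r) ∧ (P (Jof u) = eof u ∨ P' (Jof u) = eof u) ∧
      rof u ∈ u.1 ∧ rof u ∉ F ∧ (P (rof u) ≠ r ∧ P' (rof u) ≠ r) ∧ (P (rof u) = eof u ∨ P' (rof u) = eof u) ∧
      rof u ≠ u.2) :
    ∑ u ∈ U, ((∏ k ∈ u.1, θ k) * ∏ k ∈ univ \ u.1, (1 - θ k)) ≤
      (6 / 8) * ∑ T ∈ U.image (fun u => ({u.2, Jof u, rof u} : Finset ι)),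
        ∑ δ ∈ ((univ : Finset (ι → Bool)).filter (fun δ => (∀ K ∉ T, δ K = false) ∧
            3 ≤ (T.image fun K => if δ K then P K else P' K).card ∧ r ∉ T.image fun K => if δ K then P K else P' K)).filter
            (fun δ => ∀ K ∈ T, K ∉ F → ∀ I ∈ T, I ∈ F → (if δ K then P K else P' K) ≠ P I ∧ (if δ K then P K else P' K) ≠ P' I),
          ∏ K ∈ T, O K (if δ K then P K else P' K) := by
  have hdata : ∀ u ∈ U, u.2 ≠ Jof u ∧ Jof u ≠ rof u ∧ ∃ ē s m : V,
      (P u.2 = ē ∨ P' u.2 = ē) ∧ (P (Jof u) = s ∨ P' (Jof u) = s) ∧ (P (rof u) = m ∨ P' (rof u) = m) ∧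
      eof u ≠ ē ∧ eof u ≠ s ∧ eof u ≠ m ∧ ē ≠ s ∧ ē ≠ m ∧ s ≠ m ∧ eof u ≠ r ∧ ē ≠ r ∧ s ≠ r ∧ m ≠ r := by
    intro u hu
    obtain ⟨-, hXF, hXr, heX, -, hJF, hJr, heJ, -, hρF, hρr, heρ, hρX⟩ := hU u hu
    have hXJ : u.2 ≠ Jof u := fun h => hXF (h ▸ hJF)
    have hJρ : Jof u ≠ rof u := fun h => hρF (h ▸ hJF)
    obtain ⟨ē, hēX, heē⟩ : ∃ ē, (P u.2 = ē ∨ P' u.2 = ē) ∧ eof u ≠ ē := by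
      rcases heX with h | h
      · exact ⟨P' u.2, Or.inr rfl, fun h' => hPP' u.2 (h.trans h')⟩
      · exact ⟨P u.2, Or.inl rfl, fun h' => hPP' u.2 (h'.symm.trans h.symm)⟩
    obtain ⟨s, hsJ, hes⟩ : ∃ s, (P (Jof u) = s ∨ P' (Jof u) = s) ∧ eof u ≠ s := by
      rcases heJ with h | h
      · exact ⟨P' (Jof u), Or.inr rfl, fun h' => hPP' (Jof u) (h.trans h')⟩
      · exact ⟨P (Jof u), Or.inl rfl, fun h' => hPP' (Jof u) (h'.symm.trans h.symm)⟩
    obtain ⟨m, hmρ, hem⟩ : ∃ m, (P (rof u) = m ∨ P' (rof u) = m) ∧ eof u ≠ m := by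
      rcases heρ with h | h
      · exact ⟨P' (rof u), Or.inr rfl, fun h' => hPP' (rof u) (h.trans h')⟩
      · exact ⟨P (rof u), Or.inl rfl, fun h' => hPP' (rof u) (h'.symm.trans h.symm)⟩
    have hēs : ē ≠ s := by
      intro h; apply hXJ; apply hinj; simp only
      rw [sym2_eq_of_mem_of_mem heē heX hēX, sym2_eq_of_mem_of_mem hes heJ hsJ, h]
    have hēm : ē ≠ m := by
      intro h; apply hρX; apply hinj; simp only
      rw [sym2_eq_of_mem_of_mem hem heρ hmρ, sym2_eq_of_mem_of_mem heē heX hēX, h]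
    have hsm : s ≠ m := by
      intro h; apply hJρ; apply hinj; simp only
      rw [sym2_eq_of_mem_of_mem hes heJ hsJ, sym2_eq_of_mem_of_mem hem heρ hmρ, h]
    have hport_r : ∀ (K : ι) (x : V), (P K ≠ r ∧ P' K ≠ r) → (P K = x ∨ P' K = x) → x ≠ r := by
      rintro K x hK (h | h)
      · rw [← h]; exact hK.1
      · rw [← h]; exact hK.2
    exact ⟨hXJ, hJρ, ē, s, m, hēX, hsJ, hmρ, heē, hes, hem, hēs, hēm, hsm, hport_r _ _ hXr heX, hport_r _ _ hXr hēX,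
      hport_r _ _ hJr hsJ, hport_r _ _ hρr hmρ⟩
  refine family_load_le θ hθ0 hθ1 U (fun u => ({u.2, Jof u, rof u} : Finset ι)) (fun u => (u.2, Jof u))
    (fun u => ({u.2, Jof u, rof u} : Finset ι))
    (fun T => ∑ δ ∈ ((univ : Finset (ι → Bool)).filter (fun δ => (∀ K ∉ T, δ K = false) ∧
        3 ≤ (T.image fun K => if δ K then P K else P' K).card ∧ r ∉ T.image fun K => if δ K then P K else P' K)).filter
        (fun δ => ∀ K ∈ T, K ∉ F → ∀ I ∈ T, I ∈ F → (if δ K then P K else P' K) ≠ P I ∧ (if δ K then P K else P' K) ≠ P' I),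
      ∏ K ∈ T, O K (if δ K then P K else P' K))
    (fun u _ => sum_nonneg fun δ _ => prod_nonneg fun K _ => hO0 _ _) 6 8 (by norm_num)
    (fun u hu => ?_) (fun u _ v _ hres hk => ?_) (fun u _ v _ _ hk huv => ?_) (fun u hu => ?_) (fun w hw => ?_) |>.trans
    (le_of_eq (by ring))
  · obtain ⟨hXS, -, -, -, hJS, -, -, -, hρS, -⟩ := hU u hu
    intro k hk
    rcases mem_insert.1 hk with rfl | hk
    · exact hXS
    rcases mem_insert.1 hk with rfl | hk
    · exact hJS
    · rw [mem_singleton.1 hk]; exact hρS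
  · exact hres
  · exact Prod.ext huv (congrArg Prod.fst hk :)
  · obtain ⟨hXJ, hJρ, ē, s, m, hēX, hsJ, hmρ, heē, hes, hem, hēs, hēm, hsm, her, hēr, hsr, hmr⟩ := hdata u hu
    obtain ⟨-, hXF, -, heX, -, -, -, heJ, -, hρF, -, -, hρX⟩ := hU u hu
    have hXnot : u.2 ∉ ({Jof u, rof u} : Finset ι) := by simp [hXJ, Ne.symm hρX]
    rw [prod_insert hXnot, prod_pair hJρ, ← mul_assoc, le_div_iff₀ (by norm_num : (0 : ℝ) < 8), mul_comm]
    exact riderC_triple_le_wc P P' r F θ hθ0 O hO0 Φ hO1 hO2 hΦ4 hXJ (Ne.symm hρX) hJρ hXF hρF heX hēX heJ hsJ hmρ heē hes hem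
      hēs hēm hsm hēr her hsr hmr
  · -- at most six keys per class-set: ordered pairs of distinct elements of a 3-set
    obtain ⟨u₀, hu₀, rfl⟩ := mem_image.1 hw
    obtain ⟨hXJ, hJρ, -⟩ := hdata u₀ hu₀
    obtain ⟨-, -, -, -, -, -, -, -, -, -, -, -, hρX⟩ := hU u₀ hu₀
    have hcard : ({u₀.2, Jof u₀, rof u₀} : Finset ι).card = 3 := by
      rw [card_insert_of_notMem (by simp [hXJ, Ne.symm hρX]), card_pair hJρ]
    have hsub : (U.filter (fun u => ({u.2, Jof u, rof u} : Finset ι) = {u₀.2, Jof u₀, rof u₀})).image (fun u => (u.2, Jof u)) ⊆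
        ({u₀.2, Jof u₀, rof u₀} : Finset ι).offDiag := by
      intro k hk
      obtain ⟨u, hu, rfl⟩ := mem_image.1 hk
      obtain ⟨huU, huw⟩ := mem_filter.1 hu
      obtain ⟨hXJ', -⟩ := hdata u huU
      refine mem_offDiag.2 ⟨?_, ?_, hXJ'⟩
      · rw [← huw]; exact mem_insert_self _ _
      · rw [← huw]; exact mem_insert_of_mem (mem_insert_self _ _)
    refine (card_le_card hsub).trans ?_
    rw [offDiag_card, hcard]

end StarSet

end Summit.CriticalPhenomena.PercolationContinuityZ3.Theorems
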